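import Summits.BirchSwinnertonDyer.BirchSwinnertonDyer.Theorems.QuadraticBranchSignedControlPlusEtaNonsurjConjADoorRecordsPrimeLA
import HarnessLib

/-!
# Route `QuadraticBranchSignedControl` (rung K8, cell `bsd-potss`), residual crux `PlusEtaMainConjectureNonsurj`
# (stmt-BirchSwinnertonDyer-19606): PRIME-`L` RECORDS THROUGH DOOR L6, part B — (C1⁺_η) at `p = 5` on NON-CM rank-one in-table rows with
# `λ⁺ = 1` from ONE class number `5 ∤ h(ℚ(P))` each: NO anchor, NO congruence, NO Hatley–Lei composite, NO Corpuz–Lei binder, NO `hS28`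
# (seat `bsd-potss-k8eta-c2` g20; census kit j323394, GRH)

WHAT. k8eta-c2 g4/g5's prime-`L` records (`EtaPrimeRoadRecords.etaMC_r1_<label>_<anchor>_5`) and g6/g8's fine-road / transfer records settled the
non-CM rank-`1` rows of crux 19606 below `5·10⁵` with `λ(L_5⁺(V,η,X)) = 1` through a CM unit ANCHOR congruent mod `5` (Kraus–Oesterlé certificate)
plus the Hatley–Lei `μ`-transfer (named composite wi-78102) or the Corpuz–Lei binder (preprint), and `hS28`. Door L6 (p690512) + the fine road
(p691623, `EtaConjADoor.quadraticBranchPlusEtaMainConjectureAt_of_not_dvd_classNumber_of_span_eq_span_X`) give the SAME conclusion from the ROW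
ALONE: named facts `h22 h41 h6273` (Kobayashi 2003) + `hGZK` (`Sel_{5^∞}(W/ℚ)` infinite from `r_an(W) = 1`); displayed per row: `r_an(W) = 1`
(Cremona), the tower clause, the shape `(L_5⁺(V,η,X)) = (X)` (PARI `λ⁺ = 1, μ⁺ = 0`, g3 table) and ONE class number `5 ∤ h(ℚ(P))`, `P ∈ W[5] ∖ 0`,
`[ℚ(P):ℚ] = 24` (this seat's census j323394, `bnfinit` under GRH). Part B: the rows 341775ca1, 341775cf1, 341775dj1, 341775dm1, 417600gp1, 417600ke1, 458100j1 (h(ℚ(P)) = 6, 3, 6, 3, 2, 2, 1), instances of part A §1.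

HONEST FRAMING (cell `bsd-potss`; FULL-BSD rank ≤ 1 programme, HUMAN RULING D-0036/D-0074): per-row RECORDS, CONDITIONAL on the displayed named
facts and per-row inputs; the class numbers are GRH numerics (evidence, not facts); no stub of 19606 is proved by name; the crux stays OPEN;
nothing is booked; `BSD(W,5)` is claimed for no pair. `--supports stmt-BirchSwinnertonDyer-19606`.

References: [Kobayashi2003] §4 (p. 8), Thm. 4.1, Thm. 2.2, Thm. 7.3 i); [CoatesSujatha2005] §3 (A); [GrossZagier1986] Thm. (7.3); [Kolyvagin1990] Thm. A;
[Cremona1997] Table 1 (labels as listed).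
-/

set_option autoImplicit false
-- sibling precedent (`KatoDescentPotSupersingularAssembly.lean`): the directory name repeats the summit name
set_option linter.dupNamespace false
noncomputable section

open scoped Classical

open CongruenceSubgroup NumberField Field WeierstrassCurve
open Literature.NumberTheory.EllipticCurves Literature.NumberTheory.EllipticCurves.ModularForms
  Literature.NumberTheory.EllipticCurves.Rank1Residual Literature.NumberTheory.GaloisRepresentations
  Literature.NumberTheory.EllipticCurves.GreenbergVatsal2000 ZpExtension
open Summit.BirchSwinnertonDyer.Rank1Residual.Additive
open Summit.BirchSwinnertonDyer.BirchSwinnertonDyer.Theorems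

namespace Summit.BirchSwinnertonDyer.BirchSwinnertonDyer.Theorems.EtaConjADoorRecords

/-! ## Rows (part B) -/

/-- **(C1⁺_η) at `p = 5` for every good `a_5 = 0` model `V` of the `5`-twist of `341775ca1`** (`W = [0,0,1,-189000,-1222594]`, non-CM, `N = 341775`, Cremona `r_an = 1`,
`Tam = 20`; PARI plus-`η` `(λ, μ) = (1, 0)`; census j323394: `h(ℚ(P)) = 6`) from the ROW ALONE — named facts `h22 h41 h6273 hGZK`; displayed
`r_an(W) = 1`, the tower clause, `(L_5⁺(V,η,X)) = (X)`, the class number. Instance of `etaMC_r1_of_classNumber`; `Δ(W) ≠ 0` reused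
(`EtaPrimeRoadRecords.isElliptic_341775ca1`). CONDITIONAL; nothing booked. [cite: Kobayashi2003, §4 (p. 8)] [cite: Cremona1997, Table 1 (label 341775ca1)] -/
theorem etaMC_r1_341775ca1_5_of_classNumber
    (h22 : Kobayashi2003.thm22_etaSignedSelmerDual_finite_torsion)
    (h41 : Kobayashi2003.thm41_plusEtaCharIdeal_dvd)
    (h6273 : Kobayashi2003.thm62_63_73_etaColemanPoitouTate)
    (hGZK : rank_eq_analyticRank_of_analyticRank_le_one) [Fact (5 : ℕ).Prime]
    (W : WeierstrassCurve ℚ) (hW : W = (⟨0, 0, 1, (-189000), (-1222594)⟩ : WeierstrassCurve ℚ)) (hr : W.analyticRank = 1)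
    (V : WeierstrassCurve ℚ) [V.IsElliptic] [V.IsGloballyMinimal] (C : VariableChange ℚ)
    (hC : C • W.quadraticTwist 5 = V)
    (hgood : V.HasGoodReductionAtPrime 5) (hap : V.frobeniusTrace 5 = 0)
    (hns : ¬ ∀ m : ℕ, V.HasSurjectiveModNGaloisRep (5 ^ m : ℕ))
    (hX : ∀ {N : ℕ} [NeZero N] {f : CuspForm (Gamma0 N) 2}, IsNewformOf V f →
      ∀ (ϖ : ℚ), (if Even (5 / 2) then (ϖ : ℝ) * V.realPeriodRat = plusPeriod f
          else (ϖ : ℝ) * V.imaginaryPeriodRat = minusPeriod f) →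
      ∀ (Lη : IwasawaAlgebra 5), IsQuadraticBranchPlusLFunction f 5 ϖ Lη →
        Ideal.span {Lη} = Ideal.span {(PowerSeries.X : IwasawaAlgebra 5)})
    (hP : haveI : W.IsElliptic := hW ▸ EtaPrimeRoadRecords.isElliptic_341775ca1
      haveI : NeZero (5 : ℕ) := ⟨by norm_num⟩
      haveI : NumberField (W.divisionField 5) := NumberField.mk
      ∃ P : geomTorsion W ((5 : ℕ) : ℤ), P ≠ 0 ∧
        ¬ 5 ∣ NumberField.classNumber (IntermediateField.fixedField
          ((MulAction.stabilizer (absoluteGaloisGroup ℚ) P).map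
            (absRestrictNormalHom (W.divisionField 5))))) :
    QuadraticBranchPlusEtaMainConjectureAt V 5 := by
  subst hW
  haveI : (⟨0, 0, 1, (-189000), (-1222594)⟩ : WeierstrassCurve ℚ).IsElliptic := EtaPrimeRoadRecords.isElliptic_341775ca1
  haveI : NeZero (5 : ℕ) := ⟨by norm_num⟩
  exact etaMC_r1_of_classNumber h22 h41 h6273 hGZK 5 (le_refl 5) _ hr V C
    (by rw [show ((-1 : ℚ) ^ ((5 : ℕ) / 2) * ((5 : ℕ) : ℚ)) = 5 by norm_num]; exact hC) hgood hap hns hX hP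

/-- **(C1⁺_η) at `p = 5` for every good `a_5 = 0` model `V` of the `5`-twist of `341775cf1`** (`W = [0,0,1,-9261000,419349656]`, non-CM, `N = 341775`, Cremona `r_an = 1`,
`Tam = 12`; PARI plus-`η` `(λ, μ) = (1, 0)`; census j323394: `h(ℚ(P)) = 3`) from the ROW ALONE — named facts `h22 h41 h6273 hGZK`; displayed
`r_an(W) = 1`, the tower clause, `(L_5⁺(V,η,X)) = (X)`, the class number. Instance of `etaMC_r1_of_classNumber`; `Δ(W) ≠ 0` reused
(`EtaFineRoadRecords.isElliptic_341775cf1`). CONDITIONAL; nothing booked. [cite: Kobayashi2003, §4 (p. 8)] [cite: Cremona1997, Table 1 (label 341775cf1)] -/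
theorem etaMC_r1_341775cf1_5_of_classNumber
    (h22 : Kobayashi2003.thm22_etaSignedSelmerDual_finite_torsion)
    (h41 : Kobayashi2003.thm41_plusEtaCharIdeal_dvd)
    (h6273 : Kobayashi2003.thm62_63_73_etaColemanPoitouTate)
    (hGZK : rank_eq_analyticRank_of_analyticRank_le_one) [Fact (5 : ℕ).Prime]
    (W : WeierstrassCurve ℚ) (hW : W = (⟨0, 0, 1, (-9261000), 419349656⟩ : WeierstrassCurve ℚ)) (hr : W.analyticRank = 1)
    (V : WeierstrassCurve ℚ) [V.IsElliptic] [V.IsGloballyMinimal] (C : VariableChange ℚ)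
    (hC : C • W.quadraticTwist 5 = V)
    (hgood : V.HasGoodReductionAtPrime 5) (hap : V.frobeniusTrace 5 = 0)
    (hns : ¬ ∀ m : ℕ, V.HasSurjectiveModNGaloisRep (5 ^ m : ℕ))
    (hX : ∀ {N : ℕ} [NeZero N] {f : CuspForm (Gamma0 N) 2}, IsNewformOf V f →
      ∀ (ϖ : ℚ), (if Even (5 / 2) then (ϖ : ℝ) * V.realPeriodRat = plusPeriod f
          else (ϖ : ℝ) * V.imaginaryPeriodRat = minusPeriod f) →
      ∀ (Lη : IwasawaAlgebra 5), IsQuadraticBranchPlusLFunction f 5 ϖ Lη →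
        Ideal.span {Lη} = Ideal.span {(PowerSeries.X : IwasawaAlgebra 5)})
    (hP : haveI : W.IsElliptic := hW ▸ EtaFineRoadRecords.isElliptic_341775cf1
      haveI : NeZero (5 : ℕ) := ⟨by norm_num⟩
      haveI : NumberField (W.divisionField 5) := NumberField.mk
      ∃ P : geomTorsion W ((5 : ℕ) : ℤ), P ≠ 0 ∧
        ¬ 5 ∣ NumberField.classNumber (IntermediateField.fixedField
          ((MulAction.stabilizer (absoluteGaloisGroup ℚ) P).map
            (absRestrictNormalHom (W.divisionField 5))))) :
    QuadraticBranchPlusEtaMainConjectureAt V 5 := by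
  subst hW
  haveI : (⟨0, 0, 1, (-9261000), 419349656⟩ : WeierstrassCurve ℚ).IsElliptic := EtaFineRoadRecords.isElliptic_341775cf1
  haveI : NeZero (5 : ℕ) := ⟨by norm_num⟩
  exact etaMC_r1_of_classNumber h22 h41 h6273 hGZK 5 (le_refl 5) _ hr V C
    (by rw [show ((-1 : ℚ) ^ ((5 : ℕ) / 2) * ((5 : ℕ) : ℚ)) = 5 by norm_num]; exact hC) hgood hap hns hX hP

/-- **(C1⁺_η) at `p = 5` for every good `a_5 = 0` model `V` of the `5`-twist of `341775dj1`** (`W = [0,0,1,-21000,45281]`, non-CM, `N = 341775`, Cremona `r_an = 1`,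
`Tam = 20`; PARI plus-`η` `(λ, μ) = (1, 0)`; census j323394: `h(ℚ(P)) = 6`) from the ROW ALONE — named facts `h22 h41 h6273 hGZK`; displayed
`r_an(W) = 1`, the tower clause, `(L_5⁺(V,η,X)) = (X)`, the class number. Instance of `etaMC_r1_of_classNumber`; `Δ(W) ≠ 0` reused
(`EtaPrimeRoadRecords.isElliptic_341775dj1`). CONDITIONAL; nothing booked. [cite: Kobayashi2003, §4 (p. 8)] [cite: Cremona1997, Table 1 (label 341775dj1)] -/
theorem etaMC_r1_341775dj1_5_of_classNumber
    (h22 : Kobayashi2003.thm22_etaSignedSelmerDual_finite_torsion)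
    (h41 : Kobayashi2003.thm41_plusEtaCharIdeal_dvd)
    (h6273 : Kobayashi2003.thm62_63_73_etaColemanPoitouTate)
    (hGZK : rank_eq_analyticRank_of_analyticRank_le_one) [Fact (5 : ℕ).Prime]
    (W : WeierstrassCurve ℚ) (hW : W = (⟨0, 0, 1, (-21000), 45281⟩ : WeierstrassCurve ℚ)) (hr : W.analyticRank = 1)
    (V : WeierstrassCurve ℚ) [V.IsElliptic] [V.IsGloballyMinimal] (C : VariableChange ℚ)
    (hC : C • W.quadraticTwist 5 = V)
    (hgood : V.HasGoodReductionAtPrime 5) (hap : V.frobeniusTrace 5 = 0)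
    (hns : ¬ ∀ m : ℕ, V.HasSurjectiveModNGaloisRep (5 ^ m : ℕ))
    (hX : ∀ {N : ℕ} [NeZero N] {f : CuspForm (Gamma0 N) 2}, IsNewformOf V f →
      ∀ (ϖ : ℚ), (if Even (5 / 2) then (ϖ : ℝ) * V.realPeriodRat = plusPeriod f
          else (ϖ : ℝ) * V.imaginaryPeriodRat = minusPeriod f) →
      ∀ (Lη : IwasawaAlgebra 5), IsQuadraticBranchPlusLFunction f 5 ϖ Lη →
        Ideal.span {Lη} = Ideal.span {(PowerSeries.X : IwasawaAlgebra 5)})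
    (hP : haveI : W.IsElliptic := hW ▸ EtaPrimeRoadRecords.isElliptic_341775dj1
      haveI : NeZero (5 : ℕ) := ⟨by norm_num⟩
      haveI : NumberField (W.divisionField 5) := NumberField.mk
      ∃ P : geomTorsion W ((5 : ℕ) : ℤ), P ≠ 0 ∧
        ¬ 5 ∣ NumberField.classNumber (IntermediateField.fixedField
          ((MulAction.stabilizer (absoluteGaloisGroup ℚ) P).map
            (absRestrictNormalHom (W.divisionField 5))))) :
    QuadraticBranchPlusEtaMainConjectureAt V 5 := by
  subst hW
  haveI : (⟨0, 0, 1, (-21000), 45281⟩ : WeierstrassCurve ℚ).IsElliptic := EtaPrimeRoadRecords.isElliptic_341775dj1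
  haveI : NeZero (5 : ℕ) := ⟨by norm_num⟩
  exact etaMC_r1_of_classNumber h22 h41 h6273 hGZK 5 (le_refl 5) _ hr V C
    (by rw [show ((-1 : ℚ) ^ ((5 : ℕ) / 2) * ((5 : ℕ) : ℚ)) = 5 by norm_num]; exact hC) hgood hap hns hX hP

/-- **(C1⁺_η) at `p = 5` for every good `a_5 = 0` model `V` of the `5`-twist of `341775dm1`** (`W = [0,0,1,-1029000,-15531469]`, non-CM, `N = 341775`, Cremona `r_an = 1`,
`Tam = 12`; PARI plus-`η` `(λ, μ) = (1, 0)`; census j323394: `h(ℚ(P)) = 3`) from the ROW ALONE — named facts `h22 h41 h6273 hGZK`; displayed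
`r_an(W) = 1`, the tower clause, `(L_5⁺(V,η,X)) = (X)`, the class number. Instance of `etaMC_r1_of_classNumber`; `Δ(W) ≠ 0` reused
(`EtaFineRoadRecords.isElliptic_341775dm1`). CONDITIONAL; nothing booked. [cite: Kobayashi2003, §4 (p. 8)] [cite: Cremona1997, Table 1 (label 341775dm1)] -/
theorem etaMC_r1_341775dm1_5_of_classNumber
    (h22 : Kobayashi2003.thm22_etaSignedSelmerDual_finite_torsion)
    (h41 : Kobayashi2003.thm41_plusEtaCharIdeal_dvd)
    (h6273 : Kobayashi2003.thm62_63_73_etaColemanPoitouTate)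
    (hGZK : rank_eq_analyticRank_of_analyticRank_le_one) [Fact (5 : ℕ).Prime]
    (W : WeierstrassCurve ℚ) (hW : W = (⟨0, 0, 1, (-1029000), (-15531469)⟩ : WeierstrassCurve ℚ)) (hr : W.analyticRank = 1)
    (V : WeierstrassCurve ℚ) [V.IsElliptic] [V.IsGloballyMinimal] (C : VariableChange ℚ)
    (hC : C • W.quadraticTwist 5 = V)
    (hgood : V.HasGoodReductionAtPrime 5) (hap : V.frobeniusTrace 5 = 0)
    (hns : ¬ ∀ m : ℕ, V.HasSurjectiveModNGaloisRep (5 ^ m : ℕ))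
    (hX : ∀ {N : ℕ} [NeZero N] {f : CuspForm (Gamma0 N) 2}, IsNewformOf V f →
      ∀ (ϖ : ℚ), (if Even (5 / 2) then (ϖ : ℝ) * V.realPeriodRat = plusPeriod f
          else (ϖ : ℝ) * V.imaginaryPeriodRat = minusPeriod f) →
      ∀ (Lη : IwasawaAlgebra 5), IsQuadraticBranchPlusLFunction f 5 ϖ Lη →
        Ideal.span {Lη} = Ideal.span {(PowerSeries.X : IwasawaAlgebra 5)})
    (hP : haveI : W.IsElliptic := hW ▸ EtaFineRoadRecords.isElliptic_341775dm1
      haveI : NeZero (5 : ℕ) := ⟨by norm_num⟩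
      haveI : NumberField (W.divisionField 5) := NumberField.mk
      ∃ P : geomTorsion W ((5 : ℕ) : ℤ), P ≠ 0 ∧
        ¬ 5 ∣ NumberField.classNumber (IntermediateField.fixedField
          ((MulAction.stabilizer (absoluteGaloisGroup ℚ) P).map
            (absRestrictNormalHom (W.divisionField 5))))) :
    QuadraticBranchPlusEtaMainConjectureAt V 5 := by
  subst hW
  haveI : (⟨0, 0, 1, (-1029000), (-15531469)⟩ : WeierstrassCurve ℚ).IsElliptic := EtaFineRoadRecords.isElliptic_341775dm1
  haveI : NeZero (5 : ℕ) := ⟨by norm_num⟩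
  exact etaMC_r1_of_classNumber h22 h41 h6273 hGZK 5 (le_refl 5) _ hr V C
    (by rw [show ((-1 : ℚ) ^ ((5 : ℕ) / 2) * ((5 : ℕ) : ℚ)) = 5 by norm_num]; exact hC) hgood hap hns hX hP

/-- **(C1⁺_η) at `p = 5` for every good `a_5 = 0` model `V` of the `5`-twist of `417600gp1`** (`W = [0,0,0,-34500,5157000]`, non-CM, `N = 417600`, Cremona `r_an = 1`,
`Tam = 4`; PARI plus-`η` `(λ, μ) = (1, 0)`; census j323394: `h(ℚ(P)) = 2`) from the ROW ALONE — named facts `h22 h41 h6273 hGZK`; displayed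
`r_an(W) = 1`, the tower clause, `(L_5⁺(V,η,X)) = (X)`, the class number. Instance of `etaMC_r1_of_classNumber`; `Δ(W) ≠ 0` reused
(`EtaFineRoadRecords.isElliptic_417600gp1`). CONDITIONAL; nothing booked. [cite: Kobayashi2003, §4 (p. 8)] [cite: Cremona1997, Table 1 (label 417600gp1)] -/
theorem etaMC_r1_417600gp1_5_of_classNumber
    (h22 : Kobayashi2003.thm22_etaSignedSelmerDual_finite_torsion)
    (h41 : Kobayashi2003.thm41_plusEtaCharIdeal_dvd)
    (h6273 : Kobayashi2003.thm62_63_73_etaColemanPoitouTate)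
    (hGZK : rank_eq_analyticRank_of_analyticRank_le_one) [Fact (5 : ℕ).Prime]
    (W : WeierstrassCurve ℚ) (hW : W = (⟨0, 0, 0, (-34500), 5157000⟩ : WeierstrassCurve ℚ)) (hr : W.analyticRank = 1)
    (V : WeierstrassCurve ℚ) [V.IsElliptic] [V.IsGloballyMinimal] (C : VariableChange ℚ)
    (hC : C • W.quadraticTwist 5 = V)
    (hgood : V.HasGoodReductionAtPrime 5) (hap : V.frobeniusTrace 5 = 0)
    (hns : ¬ ∀ m : ℕ, V.HasSurjectiveModNGaloisRep (5 ^ m : ℕ))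
    (hX : ∀ {N : ℕ} [NeZero N] {f : CuspForm (Gamma0 N) 2}, IsNewformOf V f →
      ∀ (ϖ : ℚ), (if Even (5 / 2) then (ϖ : ℝ) * V.realPeriodRat = plusPeriod f
          else (ϖ : ℝ) * V.imaginaryPeriodRat = minusPeriod f) →
      ∀ (Lη : IwasawaAlgebra 5), IsQuadraticBranchPlusLFunction f 5 ϖ Lη →
        Ideal.span {Lη} = Ideal.span {(PowerSeries.X : IwasawaAlgebra 5)})
    (hP : haveI : W.IsElliptic := hW ▸ EtaFineRoadRecords.isElliptic_417600gp1
      haveI : NeZero (5 : ℕ) := ⟨by norm_num⟩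
      haveI : NumberField (W.divisionField 5) := NumberField.mk
      ∃ P : geomTorsion W ((5 : ℕ) : ℤ), P ≠ 0 ∧
        ¬ 5 ∣ NumberField.classNumber (IntermediateField.fixedField
          ((MulAction.stabilizer (absoluteGaloisGroup ℚ) P).map
            (absRestrictNormalHom (W.divisionField 5))))) :
    QuadraticBranchPlusEtaMainConjectureAt V 5 := by
  subst hW
  haveI : (⟨0, 0, 0, (-34500), 5157000⟩ : WeierstrassCurve ℚ).IsElliptic := EtaFineRoadRecords.isElliptic_417600gp1
  haveI : NeZero (5 : ℕ) := ⟨by norm_num⟩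
  exact etaMC_r1_of_classNumber h22 h41 h6273 hGZK 5 (le_refl 5) _ hr V C
    (by rw [show ((-1 : ℚ) ^ ((5 : ℕ) / 2) * ((5 : ℕ) : ℚ)) = 5 by norm_num]; exact hC) hgood hap hns hX hP

/-- **(C1⁺_η) at `p = 5` for every good `a_5 = 0` model `V` of the `5`-twist of `417600ke1`** (`W = [0,0,0,-310500,139239000]`, non-CM, `N = 417600`, Cremona `r_an = 1`,
`Tam = 20`; PARI plus-`η` `(λ, μ) = (1, 0)`; census j323394: `h(ℚ(P)) = 2`) from the ROW ALONE — named facts `h22 h41 h6273 hGZK`; displayed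
`r_an(W) = 1`, the tower clause, `(L_5⁺(V,η,X)) = (X)`, the class number. Instance of `etaMC_r1_of_classNumber`; `Δ(W) ≠ 0` reused
(`EtaPrimeRoadRecords.isElliptic_417600ke1`). CONDITIONAL; nothing booked. [cite: Kobayashi2003, §4 (p. 8)] [cite: Cremona1997, Table 1 (label 417600ke1)] -/
theorem etaMC_r1_417600ke1_5_of_classNumber
    (h22 : Kobayashi2003.thm22_etaSignedSelmerDual_finite_torsion)
    (h41 : Kobayashi2003.thm41_plusEtaCharIdeal_dvd)
    (h6273 : Kobayashi2003.thm62_63_73_etaColemanPoitouTate)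
    (hGZK : rank_eq_analyticRank_of_analyticRank_le_one) [Fact (5 : ℕ).Prime]
    (W : WeierstrassCurve ℚ) (hW : W = (⟨0, 0, 0, (-310500), 139239000⟩ : WeierstrassCurve ℚ)) (hr : W.analyticRank = 1)
    (V : WeierstrassCurve ℚ) [V.IsElliptic] [V.IsGloballyMinimal] (C : VariableChange ℚ)
    (hC : C • W.quadraticTwist 5 = V)
    (hgood : V.HasGoodReductionAtPrime 5) (hap : V.frobeniusTrace 5 = 0)
    (hns : ¬ ∀ m : ℕ, V.HasSurjectiveModNGaloisRep (5 ^ m : ℕ))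
    (hX : ∀ {N : ℕ} [NeZero N] {f : CuspForm (Gamma0 N) 2}, IsNewformOf V f →
      ∀ (ϖ : ℚ), (if Even (5 / 2) then (ϖ : ℝ) * V.realPeriodRat = plusPeriod f
          else (ϖ : ℝ) * V.imaginaryPeriodRat = minusPeriod f) →
      ∀ (Lη : IwasawaAlgebra 5), IsQuadraticBranchPlusLFunction f 5 ϖ Lη →
        Ideal.span {Lη} = Ideal.span {(PowerSeries.X : IwasawaAlgebra 5)})
    (hP : haveI : W.IsElliptic := hW ▸ EtaPrimeRoadRecords.isElliptic_417600ke1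
      haveI : NeZero (5 : ℕ) := ⟨by norm_num⟩
      haveI : NumberField (W.divisionField 5) := NumberField.mk
      ∃ P : geomTorsion W ((5 : ℕ) : ℤ), P ≠ 0 ∧
        ¬ 5 ∣ NumberField.classNumber (IntermediateField.fixedField
          ((MulAction.stabilizer (absoluteGaloisGroup ℚ) P).map
            (absRestrictNormalHom (W.divisionField 5))))) :
    QuadraticBranchPlusEtaMainConjectureAt V 5 := by
  subst hW
  haveI : (⟨0, 0, 0, (-310500), 139239000⟩ : WeierstrassCurve ℚ).IsElliptic := EtaPrimeRoadRecords.isElliptic_417600ke1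
  haveI : NeZero (5 : ℕ) := ⟨by norm_num⟩
  exact etaMC_r1_of_classNumber h22 h41 h6273 hGZK 5 (le_refl 5) _ hr V C
    (by rw [show ((-1 : ℚ) ^ ((5 : ℕ) / 2) * ((5 : ℕ) : ℚ)) = 5 by norm_num]; exact hC) hgood hap hns hX hP

/-- **(C1⁺_η) at `p = 5` for every good `a_5 = 0` model `V` of the `5`-twist of `458100j1`** (`W = [0,0,0,-213033375,1194190269750]`, non-CM, `N = 458100`, Cremona `r_an = 1`,
`Tam = 20`; PARI plus-`η` `(λ, μ) = (1, 0)`; census j323394: `h(ℚ(P)) = 1`) from the ROW ALONE — named facts `h22 h41 h6273 hGZK`; displayed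
`r_an(W) = 1`, the tower clause, `(L_5⁺(V,η,X)) = (X)`, the class number. Instance of `etaMC_r1_of_classNumber`; `Δ(W) ≠ 0` reused
(`EtaPrimeRoadRecords.isElliptic_458100j1`). CONDITIONAL; nothing booked. [cite: Kobayashi2003, §4 (p. 8)] [cite: Cremona1997, Table 1 (label 458100j1)] -/
theorem etaMC_r1_458100j1_5_of_classNumber
    (h22 : Kobayashi2003.thm22_etaSignedSelmerDual_finite_torsion)
    (h41 : Kobayashi2003.thm41_plusEtaCharIdeal_dvd)
    (h6273 : Kobayashi2003.thm62_63_73_etaColemanPoitouTate)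
    (hGZK : rank_eq_analyticRank_of_analyticRank_le_one) [Fact (5 : ℕ).Prime]
    (W : WeierstrassCurve ℚ) (hW : W = (⟨0, 0, 0, (-213033375), 1194190269750⟩ : WeierstrassCurve ℚ)) (hr : W.analyticRank = 1)
    (V : WeierstrassCurve ℚ) [V.IsElliptic] [V.IsGloballyMinimal] (C : VariableChange ℚ)
    (hC : C • W.quadraticTwist 5 = V)
    (hgood : V.HasGoodReductionAtPrime 5) (hap : V.frobeniusTrace 5 = 0)
    (hns : ¬ ∀ m : ℕ, V.HasSurjectiveModNGaloisRep (5 ^ m : ℕ))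
    (hX : ∀ {N : ℕ} [NeZero N] {f : CuspForm (Gamma0 N) 2}, IsNewformOf V f →
      ∀ (ϖ : ℚ), (if Even (5 / 2) then (ϖ : ℝ) * V.realPeriodRat = plusPeriod f
          else (ϖ : ℝ) * V.imaginaryPeriodRat = minusPeriod f) →
      ∀ (Lη : IwasawaAlgebra 5), IsQuadraticBranchPlusLFunction f 5 ϖ Lη →
        Ideal.span {Lη} = Ideal.span {(PowerSeries.X : IwasawaAlgebra 5)})
    (hP : haveI : W.IsElliptic := hW ▸ EtaPrimeRoadRecords.isElliptic_458100j1
      haveI : NeZero (5 : ℕ) := ⟨by norm_num⟩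
      haveI : NumberField (W.divisionField 5) := NumberField.mk
      ∃ P : geomTorsion W ((5 : ℕ) : ℤ), P ≠ 0 ∧
        ¬ 5 ∣ NumberField.classNumber (IntermediateField.fixedField
          ((MulAction.stabilizer (absoluteGaloisGroup ℚ) P).map
            (absRestrictNormalHom (W.divisionField 5))))) :
    QuadraticBranchPlusEtaMainConjectureAt V 5 := by
  subst hW
  haveI : (⟨0, 0, 0, (-213033375), 1194190269750⟩ : WeierstrassCurve ℚ).IsElliptic := EtaPrimeRoadRecords.isElliptic_458100j1
  haveI : NeZero (5 : ℕ) := ⟨by norm_num⟩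
  exact etaMC_r1_of_classNumber h22 h41 h6273 hGZK 5 (le_refl 5) _ hr V C
    (by rw [show ((-1 : ℚ) ^ ((5 : ℕ) / 2) * ((5 : ℕ) : ℚ)) = 5 by norm_num]; exact hC) hgood hap hns hX hP

end Summit.BirchSwinnertonDyer.BirchSwinnertonDyer.Theorems.EtaConjADoorRecords

end
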